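import Literature.Barriers.MatrixMultiplication.IrreversibilityBarrier
import Literature.Barriers.MatrixMultiplication.UniversalMethodBarrierCor28
import HarnessLib

/-!
# `ω(⟨2⟩, t) = log₂ R̃(t)` and `ω(t, ⟨2⟩) = 1 / log₂ Q̃(t)` — proof of `CVZ2021_relativeExponent_unit`

Topic `Literature/Barriers/MatrixMultiplication`; DISCHARGE of the named fact
`CVZ2021_relativeExponent_unit` of `IrreversibilityBarrier.lean`:
M. Christandl, P. Vrana, J. Zuiddam, *Barriers for fast matrix multiplication from irreversibility*,
Theory of Computing 17 (2021) = arXiv:1812.06952, §2.2 (arXiv p. 5): "The reader verifies directly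
that the identities `ω(⟨2⟩, t) = log₂ R̃(t)`, `ω(t, ⟨2⟩) = 1/(log₂ Q̃(t))` hold." The paper prints
no proof; the argument below is the routine one, organised so that Fekete's lemma is not needed
(the tree's `relativeExponent`, `asymptoticRank`, `asymptoticSubrank` are the infimum / infimum /
supremum forms of the printed limits, `RelativeExponent.lean`, `AsymptoticSpectrum.lean`).
Everything here is PROVED (sorry-free); the main theorem is `CVZ2021_relativeExponent_unit_holds`.

## Proof architecture

* `⟨q⟩^{⊗m} ≅ ⟨q^m⟩` (relabelling, `kroneckerPow_unitTensor_eq`), hence (BCS (14.19), both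
  directions in the tree) `⟨2⟩^{⊗m} ≥ s ⟺ R(s) ≤ 2^m` (`kroneckerPow_unitTensor_restrictsTo_iff`)
  and `min {m | ⟨2⟩^{⊗m} ≥ t^{⊗N}} = ⌈log₂ R(t^{⊗N})⌉ = Nat.clog 2 (R(t^{⊗N}))`
  (`restrictionCost_unitTensor_two`).
* The subrank set `{s | t ≥ ⟨s⟩}` is bounded by `|ι|` (Tao's slice-rank lemma, in the tree as
  `le_sliceRank_of_restrictsTo_unitTensor`, `sliceRank_le_card`), so `Q(t)` is attained,
  `t ≥ ⟨n⟩ ⟺ n ≤ Q(t)`, `1 ≤ Q(t^{⊗m}) ≤ |ι|^m` for `t ≠ 0`, `Q(t^{⊗m})^k ≤ Q(t^{⊗km})`, and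
  `min {m | t^{⊗m} ≥ ⟨2⟩^{⊗N}} = min {m | 2^N ≤ Q(t^{⊗m})}` (`restrictionCost_to_unitTensor_two`).
* Two purely numerical sandwich lemmas (`iInf_clog_div_eq_logb_iInf_rpow`,
  `iInf_div_eq_one_div_logb_iSup`) then give the two identities; they use only
  `R(t^{⊗kn}) ≤ R(t^{⊗n})^k` (`tensorRank_kroneckerPow_mul`, `tensorRank_kroneckerPow_le`), resp.
  the properties of `Q` just listed, and the Archimedean property. Assumption 1 (`t` is not a triad)
  is used only through `t ≠ 0`; for `Q̃(t) = 1` both sides of the second identity are `0`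
  (`1 / log₂ 1 = 0` in Lean and every defining set is empty), as announced in the docstring of the
  fact.

## References

* M. Christandl, P. Vrana, J. Zuiddam, ToC 17 (2021), art. 2 = arXiv:1812.06952, §2.1–§2.2.
  [ChristandlVranaZuiddam2021]
* P. Bürgisser, M. Clausen, M. A. Shokrollahi, *Algebraic Complexity Theory* (1997), (14.19)
  (`R(t) ≤ r ⟺ t ≤ ⟨r⟩`). [BurgisserClausenShokrollahi1997]
-/

noncomputable section

open scoped BigOperators

namespace Literature.Barriers.MatrixMultiplication

open Literature.Computability.AlgebraicComplexity

universe u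

/-! ## Two numerical sandwich lemmas -/

section Numerical

/-- `log₂ R ≤ ⌈log₂ R⌉ = clog 2 R` for a natural number `R ≥ 1`. [folklore] -/
theorem logb_le_clog {R : ℕ} (hR : 1 ≤ R) : Real.logb 2 R ≤ Nat.clog 2 R := by
  have h := Nat.le_pow_clog one_lt_two R
  have hpos : (0 : ℝ) < R := by exact_mod_cast hR
  have h' : (R : ℝ) ≤ (2 : ℝ) ^ ((Nat.clog 2 R : ℕ) : ℝ) := by
    rw [Real.rpow_natCast]
    exact_mod_cast h
  exact (Real.logb_le_iff_le_rpow one_lt_two hpos).2 h'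

/-- `⌈log₂ R⌉ = clog 2 R ≤ log₂ R + 1` for a natural number `R ≥ 1`. [folklore] -/
theorem clog_le_logb_add_one {R : ℕ} (hR : 1 ≤ R) : (Nat.clog 2 R : ℝ) ≤ Real.logb 2 R + 1 := by
  rcases hR.eq_or_lt with h1 | h1
  · subst h1
    simp
  · have h := Nat.pow_pred_clog_lt_self one_lt_two h1
    have hpos := Nat.clog_pos one_lt_two h1
    have hRpos : (0 : ℝ) < R := by exact_mod_cast (zero_lt_one.trans h1)
    have h' : (((Nat.clog 2 R).pred : ℕ) : ℝ) < Real.logb 2 R := by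
      rw [Real.lt_logb_iff_rpow_lt one_lt_two hRpos, Real.rpow_natCast]
      exact_mod_cast h
    have hc : (((Nat.clog 2 R).pred : ℕ) : ℝ) + 1 = (Nat.clog 2 R : ℝ) := by
      exact_mod_cast Nat.succ_pred_eq_of_pos hpos
    linarith

/-- **The numerical core of `ω(⟨2⟩, t) = log₂ R̃(t)`** (CVZ §2.2, first identity): for any
sequence of natural numbers `R n ≥ 1` with `R(kn) ≤ R(n)^k` (here: `R n = R(t^{⊗n})`),
`inf_{n ≥ 1} ⌈log₂ R(n)⌉ / n = log₂ inf_{n ≥ 1} R(n)^{1/n}` (both indexed by `n + 1`, `n : ℕ`). The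
inequality `≥` is termwise (`⌈x⌉ ≥ x`); for `≤`, if `log₂ R(n) < n·A` (`A` the left side) then
`knA ≤ ⌈log₂ R(kn)⌉ ≤ ⌈k log₂ R(n)⌉ < k log₂ R(n) + 1` for all `k`, contradicting Archimedes.
[cite: ChristandlVranaZuiddam2021, §2.2] -/
theorem iInf_clog_div_eq_logb_iInf_rpow (R : ℕ → ℕ) (hR1 : ∀ n, 1 ≤ R n)
    (hmul : ∀ k n, R (k * n) ≤ R n ^ k) :
    (⨅ n : ℕ, (Nat.clog 2 (R (n + 1)) : ℝ) / ((n : ℝ) + 1)) =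
      Real.logb 2 (⨅ n : ℕ, ((R (n + 1) : ℝ) ^ ((n : ℝ) + 1)⁻¹)) := by
  set A := ⨅ n : ℕ, (Nat.clog 2 (R (n + 1)) : ℝ) / ((n : ℝ) + 1) with hA
  set B := ⨅ n : ℕ, ((R (n + 1) : ℝ) ^ ((n : ℝ) + 1)⁻¹) with hB
  have hbddA : BddBelow (Set.range fun n : ℕ => (Nat.clog 2 (R (n + 1)) : ℝ) / ((n : ℝ) + 1)) :=
    ⟨0, by rintro _ ⟨n, rfl⟩; positivity⟩
  have hbddB : BddBelow (Set.range fun n : ℕ => ((R (n + 1) : ℝ) ^ ((n : ℝ) + 1)⁻¹)) :=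
    ⟨0, by rintro _ ⟨n, rfl⟩; positivity⟩
  have hB1 : 1 ≤ B := le_ciInf fun n => Real.one_le_rpow (by exact_mod_cast hR1 (n + 1)) (by positivity)
  have hBpos : 0 < B := one_pos.trans_le hB1
  have hRpos : ∀ n, (0 : ℝ) < R n := fun n => by exact_mod_cast hR1 n
  -- `A ≤ log₂ R(n)/n` would follow from the multiplicativity; we argue by contradiction below.
  refine le_antisymm ?_ ?_
  · -- `A ≤ log₂ B`
    by_contra hlt
    rw [not_le] at hlt
    -- `B < 2^A`, hence some term is `< 2^A`
    have hB2 : B < (2 : ℝ) ^ A := (Real.logb_lt_iff_lt_rpow one_lt_two hBpos).1 hlt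
    obtain ⟨N, hN⟩ := exists_lt_of_ciInf_lt hB2
    -- `log₂ R(N+1) < (N+1) A`
    have hN' : Real.logb 2 (R (N + 1)) < ((N : ℝ) + 1) * A := by
      have h1 : Real.logb 2 (((R (N + 1) : ℝ) ^ ((N : ℝ) + 1)⁻¹)) < A := by
        rw [Real.logb_lt_iff_lt_rpow one_lt_two (Real.rpow_pos_of_pos (hRpos _) _)]
        exact hN
      rw [Real.logb_rpow_eq_mul_logb_of_pos (hRpos _)] at h1
      have hn0 : (0 : ℝ) < (N : ℝ) + 1 := by positivity
      have := mul_lt_mul_of_pos_left h1 hn0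
      rwa [← mul_assoc, mul_inv_cancel₀ hn0.ne', one_mul] at this
    set n := N + 1 with hn
    set r := Real.logb 2 (R n) with hr
    have hnR : ((N : ℝ) + 1) = (n : ℝ) := by rw [hn]; push_cast; ring
    rw [hnR] at hN'
    set δ := (n : ℝ) * A - r with hδ
    have hδpos : 0 < δ := by rw [hδ]; linarith
    -- Archimedes: `k δ > 1`
    obtain ⟨k, hk⟩ := exists_nat_gt (1 / δ)
    have hkpos' : (0 : ℝ) < k := (div_pos one_pos hδpos).trans hk
    have hkpos : 0 < k := by exact_mod_cast hkpos'
    have hkδ : 1 < (k : ℝ) * δ := by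
      rwa [div_lt_iff₀ hδpos] at hk
    -- `A ≤ clog₂ R(kn) / (kn)`
    have hkn : 1 ≤ k * n := Nat.mul_pos hkpos (Nat.succ_pos N)
    obtain ⟨j, hj⟩ : ∃ j, k * n = j + 1 := ⟨k * n - 1, by omega⟩
    have hAle : A ≤ (Nat.clog 2 (R (k * n)) : ℝ) / ((k : ℝ) * n) := by
      have := ciInf_le hbddA j
      have hjR : ((j : ℝ) + 1) = (k : ℝ) * n := by
        have : ((j + 1 : ℕ) : ℝ) = ((k * n : ℕ) : ℝ) := by rw [hj]
        push_cast at this; linarith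
      rw [hj]
      rw [hjR] at this
      exact this
    -- `clog₂ R(kn) ≤ k r + 1`
    have hclog : (Nat.clog 2 (R (k * n)) : ℝ) ≤ (k : ℝ) * r + 1 := by
      have h1 : Nat.clog 2 (R (k * n)) ≤ Nat.clog 2 (R n ^ k) := Nat.clog_mono_right 2 (hmul k n)
      have h2 : (Nat.clog 2 (R n ^ k) : ℝ) ≤ Real.logb 2 ((R n ^ k : ℕ) : ℝ) + 1 :=
        clog_le_logb_add_one (Nat.one_le_pow _ _ (hR1 n))
      have h3 : Real.logb 2 ((R n ^ k : ℕ) : ℝ) = (k : ℝ) * r := by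
        push_cast
        rw [Real.logb_pow]
      calc (Nat.clog 2 (R (k * n)) : ℝ) ≤ (Nat.clog 2 (R n ^ k) : ℝ) := by exact_mod_cast h1
        _ ≤ (k : ℝ) * r + 1 := by rw [← h3]; exact h2
    have hknpos : (0 : ℝ) < (k : ℝ) * n := by
      have : (0 : ℝ) < k := by exact_mod_cast hkpos
      have : (0 : ℝ) < (n : ℝ) := by rw [hn]; positivity
      positivity
    have h4 : A * ((k : ℝ) * n) ≤ (k : ℝ) * r + 1 := by
      have := (le_div_iff₀ hknpos).1 (hAle.trans (div_le_div_of_nonneg_right hclog hknpos.le))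
      exact this
    -- contradiction: `k δ = k (n A - r) ≤ 1`
    have : (k : ℝ) * δ ≤ 1 := by rw [hδ]; nlinarith
    linarith
  · -- `log₂ B ≤ A`
    refine le_ciInf fun n => ?_
    have h1 : B ≤ ((R (n + 1) : ℝ) ^ ((n : ℝ) + 1)⁻¹) := ciInf_le hbddB n
    have hn0 : (0 : ℝ) < (n : ℝ) + 1 := by positivity
    calc Real.logb 2 B ≤ Real.logb 2 (((R (n + 1) : ℝ) ^ ((n : ℝ) + 1)⁻¹)) :=
          Real.logb_le_logb_of_le one_lt_two hBpos h1
      _ = ((n : ℝ) + 1)⁻¹ * Real.logb 2 (R (n + 1)) := Real.logb_rpow_eq_mul_logb_of_pos (hRpos _)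
      _ ≤ ((n : ℝ) + 1)⁻¹ * (Nat.clog 2 (R (n + 1)) : ℝ) :=
          mul_le_mul_of_nonneg_left (logb_le_clog (hR1 _)) (by positivity)
      _ = (Nat.clog 2 (R (n + 1)) : ℝ) / ((n : ℝ) + 1) := by rw [inv_mul_eq_div]

/-- **The numerical core of `ω(t, ⟨2⟩) = 1 / log₂ Q̃(t)`** (CVZ §2.2, second identity): for any
sequence of natural numbers `1 ≤ Q m ≤ C^m` with `Q(m)^k ≤ Q(km)` (here: `Q m = Q(t^{⊗m})`,
`C = |ι|`) and `d N = min {m | 2^N ≤ Q m}` (`Nat.sInf`, so `0` on the empty set),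
`inf_{N ≥ 1} d(N)/N = 1 / log₂ sup_{m ≥ 1} Q(m)^{1/m}` (both indexed by `· + 1`). If `Q ≡ 1` both
sides are `0` (`1 / log₂ 1 = 1/0 = 0` in Lean, every defining set being empty); otherwise all sets
are nonempty, `≥` holds termwise (`2^N ≤ Q(d N)` gives `log₂ Q̃ ≥ N / d N`), and `≤` follows from
`d(⌊k log₂ Q m⌋) ≤ km` for all `k` and Archimedes. [cite: ChristandlVranaZuiddam2021, §2.2] -/
theorem iInf_div_eq_one_div_logb_iSup (Q d : ℕ → ℕ) (C : ℕ) (hQ1 : ∀ m, 1 ≤ Q m)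
    (hQC : ∀ m, Q m ≤ C ^ m) (hmul : ∀ k m, Q m ^ k ≤ Q (k * m))
    (hd : ∀ N, d N = sInf {m : ℕ | 2 ^ N ≤ Q m}) :
    (⨅ n : ℕ, (d (n + 1) : ℝ) / ((n : ℝ) + 1)) =
      1 / Real.logb 2 (⨆ m : ℕ, ((Q (m + 1) : ℝ) ^ ((m : ℝ) + 1)⁻¹)) := by
  set S := ⨆ m : ℕ, ((Q (m + 1) : ℝ) ^ ((m : ℝ) + 1)⁻¹) with hS
  have hQpos : ∀ m, (0 : ℝ) < Q m := fun m => by exact_mod_cast hQ1 m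
  have hterm_le : ∀ m, ((Q (m + 1) : ℝ) ^ ((m : ℝ) + 1)⁻¹) ≤ C := by
    intro m
    have h1 : (Q (m + 1) : ℝ) ≤ (C : ℝ) ^ (m + 1) := by exact_mod_cast hQC (m + 1)
    have hexp : ((m : ℝ) + 1)⁻¹ = (((m + 1 : ℕ) : ℝ))⁻¹ := by push_cast; ring
    calc ((Q (m + 1) : ℝ) ^ ((m : ℝ) + 1)⁻¹) ≤ ((C : ℝ) ^ (m + 1)) ^ ((m : ℝ) + 1)⁻¹ :=
          Real.rpow_le_rpow (Nat.cast_nonneg _) h1 (by positivity)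
      _ = C := by rw [hexp, Real.pow_rpow_inv_natCast (Nat.cast_nonneg _) (Nat.succ_ne_zero m)]
  have hbdd : BddAbove (Set.range fun m : ℕ => ((Q (m + 1) : ℝ) ^ ((m : ℝ) + 1)⁻¹)) :=
    ⟨C, by rintro _ ⟨m, rfl⟩; exact hterm_le m⟩
  have hterm_le_S : ∀ m, ((Q (m + 1) : ℝ) ^ ((m : ℝ) + 1)⁻¹) ≤ S := fun m => le_ciSup hbdd m
  have hS1 : 1 ≤ S :=
    le_trans (Real.one_le_rpow (by exact_mod_cast hQ1 (0 + 1)) (by positivity)) (hterm_le_S 0)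
  have hSpos : 0 < S := one_pos.trans_le hS1
  have hbddA : BddBelow (Set.range fun n : ℕ => (d (n + 1) : ℝ) / ((n : ℝ) + 1)) :=
    ⟨0, by rintro _ ⟨n, rfl⟩; positivity⟩
  have hd_le : ∀ N m, 2 ^ N ≤ Q m → d N ≤ m := fun N m h => by rw [hd]; exact Nat.sInf_le h
  by_cases hall : ∀ m, Q m ≤ 1
  · -- Case 1: `Q ≡ 1`, both sides vanish.
    have hQ : ∀ m, Q m = 1 := fun m => le_antisymm (hall m) (hQ1 m)
    have hS' : S = 1 := by
      rw [hS]
      simp [hQ]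
    have hdN : ∀ n, d (n + 1) = 0 := by
      intro n
      rw [hd]
      have : {m : ℕ | 2 ^ (n + 1) ≤ Q m} = ∅ := by
        ext m
        simp only [Set.mem_setOf_eq, Set.mem_empty_iff_false, iff_false, not_le, hQ]
        exact Nat.one_lt_two_pow (Nat.succ_ne_zero n)
      rw [this, Nat.sInf_empty]
    rw [hS', Real.logb_one, div_zero]
    simp [hdN]
  · -- Case 2: some `Q m₀ ≥ 2`.
    push Not at hall
    obtain ⟨m₀, hlt⟩ := hall
    have hm₀pos : 0 < m₀ := by
      rcases Nat.eq_zero_or_pos m₀ with h | h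
      · subst h
        have := hQC 0
        simp at this
        omega
      · exact h
    have h2le : 2 ≤ Q m₀ := hlt
    have hne : ∀ N, 2 ^ N ≤ Q (N * m₀) := fun N =>
      (Nat.pow_le_pow_left h2le N).trans (hmul N m₀)
    have hd_mem : ∀ N, 2 ^ N ≤ Q (d N) := fun N => by
      rw [hd]
      exact Nat.sInf_mem (s := {m | 2 ^ N ≤ Q m}) ⟨N * m₀, hne N⟩
    have hd_pos : ∀ N, 1 ≤ N → 1 ≤ d N := by
      intro N hN
      by_contra h0
      have h0' : d N = 0 := by omega
      have h1 := hd_mem N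
      rw [h0'] at h1
      have hQ0 : Q 0 ≤ 1 := by simpa using hQC 0
      have h2 : 2 ≤ 2 ^ N := by
        calc 2 = 2 ^ 1 := (pow_one 2).symm
          _ ≤ 2 ^ N := Nat.pow_le_pow_right two_pos hN
      omega
    set L := Real.logb 2 S with hL
    have hS_gt : 1 < S := by
      obtain ⟨M, rfl⟩ : ∃ M, m₀ = M + 1 := ⟨m₀ - 1, by omega⟩
      refine lt_of_lt_of_le ?_ (hterm_le_S M)
      exact Real.one_lt_rpow (by exact_mod_cast hlt) (by positivity)
    have hLpos : 0 < L := Real.logb_pos one_lt_two hS_gt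
    refine le_antisymm ?_ ?_
    · -- `inf ≤ 1/L`, by contradiction
      by_contra hlt'
      rw [not_le] at hlt'
      set A := ⨅ n : ℕ, (d (n + 1) : ℝ) / ((n : ℝ) + 1) with hA
      have hApos : 0 < A := (div_pos one_pos hLpos).trans hlt'
      have h1 : 1 / A < L := by rwa [one_div_lt hLpos hApos] at hlt'
      have h2 : (2 : ℝ) ^ (1 / A) < S := (Real.lt_logb_iff_rpow_lt one_lt_two hSpos).1 h1
      obtain ⟨M, hM⟩ := exists_lt_of_lt_ciSup h2
      set m := M + 1 with hm
      set g := Real.logb 2 (Q m) with hg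
      have h3 : 1 / A < ((M : ℝ) + 1)⁻¹ * g := by
        have := (Real.lt_logb_iff_rpow_lt one_lt_two (Real.rpow_pos_of_pos (hQpos _) _)).2 hM
        rwa [Real.logb_rpow_eq_mul_logb_of_pos (hQpos _)] at this
      have hmR : ((M : ℝ) + 1) = (m : ℝ) := by rw [hm]; push_cast; ring
      have hmpos : (0 : ℝ) < m := by rw [← hmR]; positivity
      rw [hmR] at h3
      have hgpos : 0 < g := by
        have h4 : 0 < (m : ℝ)⁻¹ * g := (div_pos one_pos hApos).trans h3
        exact (mul_pos_iff_of_pos_left (inv_pos.2 hmpos)).1 h4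
      have hAg : (m : ℝ) < A * g := by
        rw [div_lt_iff₀ hApos] at h3
        have h4 := mul_lt_mul_of_pos_left h3 hmpos
        rw [mul_one, ← mul_assoc, ← mul_assoc, mul_inv_cancel₀ hmpos.ne', one_mul] at h4
        linarith [h4]
      set δ := A * g - m with hδ
      have hδpos : 0 < δ := by rw [hδ]; linarith
      obtain ⟨k, hk⟩ := exists_nat_gt (max (A / δ) (1 / g))
      have hk1 : A / δ < k := (le_max_left _ _).trans_lt hk
      have hk2 : 1 / g < k := (le_max_right _ _).trans_lt hk
      have hkg1 : 1 < (k : ℝ) * g := by rwa [div_lt_iff₀ hgpos] at hk2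
      set N := ⌊(k : ℝ) * g⌋₊ with hN
      have hN1 : 1 ≤ N := by
        rw [hN]
        exact Nat.le_floor (by exact_mod_cast hkg1.le)
      have hNle : (N : ℝ) ≤ (k : ℝ) * g := Nat.floor_le (by positivity)
      have hNgt : (k : ℝ) * g < (N : ℝ) + 1 := Nat.lt_floor_add_one _
      have hpow : 2 ^ N ≤ Q (k * m) := by
        have h5 : ((2 ^ N : ℕ) : ℝ) ≤ ((Q m ^ k : ℕ) : ℝ) := by
          push_cast
          calc (2 : ℝ) ^ N = (2 : ℝ) ^ (N : ℝ) := (Real.rpow_natCast _ _).symm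
            _ ≤ (2 : ℝ) ^ ((k : ℝ) * g) := Real.rpow_le_rpow_of_exponent_le one_le_two hNle
            _ = ((2 : ℝ) ^ g) ^ (k : ℝ) := by rw [mul_comm, Real.rpow_mul (by norm_num)]
            _ = (Q m : ℝ) ^ (k : ℝ) := by rw [hg, Real.rpow_logb two_pos (by norm_num) (hQpos _)]
            _ = (Q m : ℝ) ^ k := Real.rpow_natCast _ _
        have h6 : 2 ^ N ≤ Q m ^ k := by exact_mod_cast h5
        exact h6.trans (hmul k m)
      have hdN : d N ≤ k * m := hd_le N (k * m) hpow
      obtain ⟨j, hj⟩ : ∃ j, N = j + 1 := ⟨N - 1, by omega⟩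
      have hAle : A ≤ (d N : ℝ) / (N : ℝ) := by
        have := ciInf_le hbddA j
        have hjR : ((j : ℝ) + 1) = (N : ℝ) := by rw [hj]; push_cast; ring
        rw [hjR, ← hj] at this
        exact this
      have hNpos : (0 : ℝ) < N := by exact_mod_cast hN1
      have h6 : A * (N : ℝ) ≤ (k : ℝ) * m := by
        have h7 : (d N : ℝ) ≤ (k : ℝ) * m := by exact_mod_cast hdN
        exact (le_div_iff₀ hNpos).1 (hAle.trans (div_le_div_of_nonneg_right h7 hNpos.le))
      have h8 : (k : ℝ) * δ < A := by
        have : A * ((k : ℝ) * g - 1) < A * N := mul_lt_mul_of_pos_left (by linarith) hApos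
        rw [hδ]
        nlinarith
      have h9 : A < (k : ℝ) * δ := by rwa [div_lt_iff₀ hδpos] at hk1
      linarith
    · -- `1/L ≤ inf`
      refine le_ciInf fun n => ?_
      have hD := hd_pos (n + 1) (Nat.succ_pos n)
      have hmem := hd_mem (n + 1)
      obtain ⟨D, hDdef⟩ : ∃ D, d (n + 1) = D + 1 := ⟨d (n + 1) - 1, by omega⟩
      have hS_ge : (2 : ℝ) ^ (((n : ℝ) + 1) / (d (n + 1) : ℝ)) ≤ S := by
        refine le_trans ?_ (hterm_le_S D)
        have hDR : ((D : ℝ) + 1) = (d (n + 1) : ℝ) := by rw [hDdef]; push_cast; ring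
        rw [hDR, ← hDdef]
        have h1 : (2 : ℝ) ^ (n + 1) ≤ (Q (d (n + 1)) : ℝ) := by exact_mod_cast hmem
        have hn1 : ((n : ℝ) + 1) = ((n + 1 : ℕ) : ℝ) := by push_cast; ring
        calc (2 : ℝ) ^ (((n : ℝ) + 1) / (d (n + 1) : ℝ))
            = ((2 : ℝ) ^ ((n : ℝ) + 1)) ^ ((d (n + 1) : ℝ))⁻¹ := by
              rw [div_eq_mul_inv, Real.rpow_mul (by norm_num)]
          _ ≤ (Q (d (n + 1)) : ℝ) ^ ((d (n + 1) : ℝ))⁻¹ := by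
              refine Real.rpow_le_rpow (by positivity) ?_ (by positivity)
              rw [hn1, Real.rpow_natCast]
              exact h1
      have hL_ge : ((n : ℝ) + 1) / (d (n + 1) : ℝ) ≤ L :=
        (Real.le_logb_iff_rpow_le one_lt_two hSpos).2 hS_ge
      have hdpos : (0 : ℝ) < d (n + 1) := by exact_mod_cast hD
      have hNpos : (0 : ℝ) < (n : ℝ) + 1 := by positivity
      have := one_div_le_one_div_of_le (div_pos hNpos hdpos) hL_ge
      rwa [one_div_div] at this


end Numerical

/-! ## Powers of unit tensors, rank and subrank of powers -/

section UnitPow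

variable {K : Type u} [CommSemiring K]

/-- **`⟨q⟩^{⊗m} ≅ ⟨q^m⟩`**: the `m`-th tensor power of the unit tensor `⟨q⟩` is the unit tensor on
`q^m` points read through any bijection `(Fin m → Fin q) ≃ Fin (q^m)` (CVZ §2.1: `⟨n⟩` is the
diagonal tensor; diagonals multiply). [cite: ChristandlVranaZuiddam2021, §2.1] -/
theorem kroneckerPow_unitTensor_eq (q m : ℕ) (e : (Fin m → Fin q) ≃ Fin (q ^ m)) :
    kroneckerPow (unitTensor K q) m = fun a b c => unitTensor K (q ^ m) (e a) (e b) (e c) := by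
  funext a b c
  simp only [kroneckerPow_apply, unitTensor_apply]
  refine prod_ite_one_zero K _ _ ⟨fun h => ?_, fun h => ?_⟩
  · have hab : a = b := funext fun l => (h l).1
    have hbc : b = c := funext fun l => (h l).2
    subst hab
    subst hbc
    exact ⟨rfl, rfl⟩
  · have hab : a = b := e.injective h.1
    have hbc : b = c := e.injective h.2
    subst hab
    subst hbc
    exact fun l => ⟨rfl, rfl⟩

/-- The cardinality of `Fin m → Fin q` is `q^m`. [folklore] -/
theorem card_fin_fun (q m : ℕ) : Fintype.card (Fin m → Fin q) = q ^ m := by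
  simp

/-- `⟨q^m⟩ ≥ ⟨q⟩^{⊗m}` (relabelling). [cite: ChristandlVranaZuiddam2021, §2.1] -/
theorem unitTensor_pow_restrictsTo (q m : ℕ) :
    TensorRestrictsTo (unitTensor K (q ^ m)) (kroneckerPow (unitTensor K q) m) := by
  rw [kroneckerPow_unitTensor_eq q m (Fintype.equivFinOfCardEq (card_fin_fun q m))]
  exact tensorRestrictsTo_precomp _ _ _ _

/-- `⟨q⟩^{⊗m} ≥ ⟨q^m⟩` (relabelling). [cite: ChristandlVranaZuiddam2021, §2.1] -/
theorem kroneckerPow_unitTensor_restrictsTo (q m : ℕ) :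
    TensorRestrictsTo (kroneckerPow (unitTensor K q) m) (unitTensor K (q ^ m)) := by
  rw [kroneckerPow_unitTensor_eq q m (Fintype.equivFinOfCardEq (card_fin_fun q m))]
  exact tensorRestrictsTo_of_reindex _ _ _ _

/-- `R(⟨r⟩) ≤ r` (the diagonal decomposition `⟨r⟩ = ∑ᵢ eᵢ ⊗ eᵢ ⊗ eᵢ`; CVZ §2.1:
`R(t) = min {n | t ≤ ⟨n⟩}`). [cite: ChristandlVranaZuiddam2021, §2.1] -/
theorem tensorRank_unitTensor_le (r : ℕ) : tensorRank (unitTensor K r) ≤ r := by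
  have h := tensorRank_le_card_of_eq_sum (t := unitTensor K r)
    (fun i a => if a = i then (1 : K) else 0) (fun i b => if b = i then (1 : K) else 0)
    (fun i c => if c = i then (1 : K) else 0) ?_
  · simpa using h
  funext a b c
  rw [Finset.sum_apply, Finset.sum_apply, Finset.sum_apply]
  simp only [triad_apply, unitTensor_apply]
  rw [Finset.sum_eq_single a (fun i _ hi => by simp [Ne.symm hi]) (by simp)]
  by_cases hab : a = b
  · subst hab
    by_cases hac : a = c
    · subst hac
      simp
    · simp [hac, Ne.symm hac]
  · simp [hab, Ne.symm hab]

variable {ι κ μ : Type*} [Fintype ι] [Fintype κ] [Fintype μ]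

/-- **`⟨q⟩^{⊗m} ≥ s ⟺ R(s) ≤ q^m`** (BCS (14.19) `R(s) ≤ r ⟺ s ≤ ⟨r⟩`, transported along
`⟨q⟩^{⊗m} ≅ ⟨q^m⟩`). [cite: BurgisserClausenShokrollahi1997, (14.19)] -/
theorem kroneckerPow_unitTensor_restrictsTo_iff (q m : ℕ) (s : ι → κ → μ → K) :
    TensorRestrictsTo (kroneckerPow (unitTensor K q) m) s ↔ tensorRank s ≤ q ^ m :=
  ⟨fun h => ((unitTensor_pow_restrictsTo q m).trans h).tensorRank_le.trans
      (tensorRank_unitTensor_le _),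
    fun h => (kroneckerPow_unitTensor_restrictsTo q m).trans
      (tensorRestrictsTo_unitTensor_of_tensorRank_le s h)⟩

/-- **`min {m | ⟨2⟩^{⊗m} ≥ t^{⊗N}} = ⌈log₂ R(t^{⊗N})⌉`** (`= Nat.clog 2 (R(t^{⊗N}))`).
[cite: ChristandlVranaZuiddam2021, §2.2] -/
theorem restrictionCost_unitTensor_two (t : ι → κ → μ → K) (N : ℕ) :
    restrictionCost (unitTensor K 2) t N = Nat.clog 2 (tensorRank (kroneckerPow t N)) := by
  unfold restrictionCost
  have hS : {m : ℕ | TensorRestrictsTo (kroneckerPow (unitTensor K 2) m) (kroneckerPow t N)} =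
      Set.Ici (Nat.clog 2 (tensorRank (kroneckerPow t N))) := by
    ext m
    rw [Set.mem_setOf_eq, Set.mem_Ici, kroneckerPow_unitTensor_restrictsTo_iff,
      Nat.clog_le_iff_le_pow one_lt_two]
  rw [hS, csInf_Ici]

end UnitPow

section Subrank

variable {K : Type u} [Field K]
variable {ι κ μ : Type*} [Fintype ι] [Fintype κ] [Fintype μ]

/-- `t ≥ ⟨n⟩ ⇒ n ≤ |ι|` (`n = S(⟨n⟩) ≤ S(t) ≤ |ι|`, Tao's slice-rank lemma and monotonicity, both
in the tree). [cite: BlasiakChurchCohnGrochowNaslundSawinUmans2017, Lemma 4.7] -/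
theorem le_card_of_restrictsTo_unitTensor {t : ι → κ → μ → K} {n : ℕ}
    (h : TensorRestrictsTo t (unitTensor K n)) : n ≤ Fintype.card ι :=
  (le_sliceRank_of_restrictsTo_unitTensor h).trans (sliceRank_le_card t)

/-- The set `{s | t ≥ ⟨s⟩}` defining the subrank is bounded (by `|ι|`). [folklore] -/
theorem bddAbove_setOf_restrictsTo_unitTensor (t : ι → κ → μ → K) :
    BddAbove {s : ℕ | TensorRestrictsTo t (unitTensor K s)} :=
  ⟨Fintype.card ι, fun _ hs => le_card_of_restrictsTo_unitTensor hs⟩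

/-- `t ≥ ⟨n⟩ ⇒ n ≤ Q(t)` (definition of the subrank as a maximum; CVZ §2.1).
[cite: ChristandlVranaZuiddam2021, §2.1] -/
theorem le_subrank_of_restrictsTo {t : ι → κ → μ → K} {n : ℕ}
    (h : TensorRestrictsTo t (unitTensor K n)) : n ≤ subrank K t :=
  le_csSup (bddAbove_setOf_restrictsTo_unitTensor t) h

/-- The subrank is attained: `t ≥ ⟨Q(t)⟩` (CVZ §2.1). [cite: ChristandlVranaZuiddam2021, §2.1] -/
theorem restrictsTo_unitTensor_subrank (t : ι → κ → μ → K) :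
    TensorRestrictsTo t (unitTensor K (subrank K t)) :=
  Nat.sSup_mem ⟨0, tensorRestrictsTo_unitTensor_zero t⟩ (bddAbove_setOf_restrictsTo_unitTensor t)

/-- **`t ≥ ⟨n⟩ ⟺ n ≤ Q(t)`** (CVZ §2.1, `Q(t) = max {n | ⟨n⟩ ≤ t}`). [cite: ChristandlVranaZuiddam2021, §2.1] -/
theorem restrictsTo_unitTensor_iff_le_subrank (t : ι → κ → μ → K) (n : ℕ) :
    TensorRestrictsTo t (unitTensor K n) ↔ n ≤ subrank K t :=
  ⟨le_subrank_of_restrictsTo,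
    fun h => (restrictsTo_unitTensor_subrank t).trans (tensorRestrictsTo_unitTensor_castLE h)⟩

/-- `Q(t) ≤ |ι|`. [cite: BlasiakChurchCohnGrochowNaslundSawinUmans2017, Lemma 4.7] -/
theorem subrank_le_card (t : ι → κ → μ → K) : subrank K t ≤ Fintype.card ι :=
  le_card_of_restrictsTo_unitTensor (restrictsTo_unitTensor_subrank t)

/-- `Q(t^{⊗m}) ≤ |ι|^m`. [cite: ChristandlVranaZuiddam2021, §2.1] -/
theorem subrank_kroneckerPow_le_card_pow (t : ι → κ → μ → K) (m : ℕ) :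
    subrank K (kroneckerPow t m) ≤ Fintype.card ι ^ m := by
  have h := subrank_le_card (kroneckerPow t m)
  rwa [Fintype.card_fun, Fintype.card_fin] at h

/-- `Q(t) ≥ 1` for `t ≠ 0` (`t ≥ ⟨1⟩`: pick a non-zero entry and rescale). [folklore] -/
theorem one_le_subrank_of_ne_zero {t : ι → κ → μ → K} (ht : t ≠ 0) : 1 ≤ subrank K t := by
  classical
  obtain ⟨a, b, c, habc⟩ : ∃ a b c, t a b c ≠ 0 := by
    by_contra hall
    push Not at hall
    exact ht (funext fun a => funext fun b => funext fun c => hall a b c)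
  refine le_subrank_of_restrictsTo ⟨fun _ a' => if a' = a then (t a b c)⁻¹ else 0,
    fun _ b' => if b' = b then 1 else 0, fun _ c' => if c' = c then 1 else 0, fun i j l => ?_⟩
  rw [unitTensor_one, Finset.sum_eq_single a (fun a' _ ha' => by simp [ha']) (by simp),
    Finset.sum_eq_single b (fun b' _ hb' => by simp [hb']) (by simp),
    Finset.sum_eq_single c (fun c' _ hc' => by simp [hc']) (by simp)]
  simp [habc]

/-- **`Q(t^{⊗m})^k ≤ Q(t^{⊗km})`** (`t^{⊗km} ≅ (t^{⊗m})^{⊗k} ≥ ⟨Q⟩^{⊗k} ≅ ⟨Q^k⟩`; CVZ §2.1: `Q` is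
super-multiplicative). [cite: ChristandlVranaZuiddam2021, §2.1] -/
theorem subrank_kroneckerPow_pow_le (t : ι → κ → μ → K) (k m : ℕ) :
    subrank K (kroneckerPow t m) ^ k ≤ subrank K (kroneckerPow t (k * m)) := by
  classical
  have h1 := ((restrictsTo_unitTensor_subrank (kroneckerPow t m)).kroneckerPow k).trans
    (kroneckerPow_unitTensor_restrictsTo (K := K) (subrank K (kroneckerPow t m)) k)
  exact le_subrank_of_restrictsTo ((tensorRestrictsTo_kroneckerPow_mul t k m).trans h1)

/-- **`min {m | t^{⊗m} ≥ ⟨2⟩^{⊗N}} = min {m | 2^N ≤ Q(t^{⊗m})}`** (`⟨2⟩^{⊗N} ≅ ⟨2^N⟩`).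
[cite: ChristandlVranaZuiddam2021, §2.2] -/
theorem restrictionCost_to_unitTensor_two (t : ι → κ → μ → K) (N : ℕ) :
    restrictionCost t (unitTensor K 2) N = sInf {m : ℕ | 2 ^ N ≤ subrank K (kroneckerPow t m)} := by
  unfold restrictionCost
  congr 1
  ext m
  simp only [Set.mem_setOf_eq]
  rw [← restrictsTo_unitTensor_iff_le_subrank]
  exact ⟨fun h => h.trans (kroneckerPow_unitTensor_restrictsTo 2 N),
    fun h => h.trans (unitTensor_pow_restrictsTo 2 N)⟩

end Subrank

/-! ## The discharge -/

section Discharge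

/-- **CVZ 2021, §2.2: `ω(⟨2⟩, t) = log₂ R̃(t)` and `ω(t, ⟨2⟩) = 1 / log₂ Q̃(t)`** for every 3-tensor
`t` over a field that is not a triad (Assumption 1; only `t ≠ 0` is used) — the discharge of the
named fact `CVZ2021_relativeExponent_unit`. [cite: ChristandlVranaZuiddam2021, §2.2] -/
theorem CVZ2021_relativeExponent_unit_holds : CVZ2021_relativeExponent_unit := by
  intro K _ ι κ μ _ _ _ t ht
  classical
  have ht0 : t ≠ 0 := by
    intro h
    refine ht 0 0 0 ?_
    rw [h]
    funext a b c
    simp [triad_apply]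
  constructor
  · unfold relativeExponent asymptoticRank
    simp_rw [restrictionCost_unitTensor_two]
    exact iInf_clog_div_eq_logb_iInf_rpow (fun n => tensorRank (kroneckerPow t n))
      (fun n => one_le_tensorRank_of_ne_zero (kroneckerPow_ne_zero ht0 n))
      (fun k n => (tensorRank_kroneckerPow_mul t k n).le.trans (tensorRank_kroneckerPow_le _ k))
  · unfold relativeExponent asymptoticSubrank
    exact iInf_div_eq_one_div_logb_iSup (fun m => subrank K (kroneckerPow t m))
      (fun N => restrictionCost t (unitTensor K 2) N) (Fintype.card ι)
      (fun m => one_le_subrank_of_ne_zero (kroneckerPow_ne_zero ht0 m))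
      (fun m => subrank_kroneckerPow_le_card_pow t m) (fun k m => subrank_kroneckerPow_pow_le t k m)
      (fun N => restrictionCost_to_unitTensor_two t N)

end Discharge

end Literature.Barriers.MatrixMultiplication

end
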